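import Summits.Ventures.HodgeRepro2.T5HeckeInvariantsDetermine
import Summits.Ventures.HodgeRepro2.T5LevelIdempotentNaturality

/-!
# Spherical representations are the irreducible quotients of `k[G/K]`

Kernel annex of the Tier-5 record (blind lane).  Frobenius reciprocity
(`T5HeckePermutationModule.frobeniusEquiv`: `Hom_G(k[G/K], π) ≅ π^K`) gives the dictionary
sentence «`π` is `K`-spherical (`π^K ≠ 0`) iff `π` is a quotient of the permutation representation
`k[G/K]`» for irreducible `π`:

* `range_orbitLinear_eq_top` — for irreducible `π` and `0 ≠ v ∈ π^K`, the `G`-map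
  `orbitLinear v : k[G/K] → π`, `δ_{gK} ↦ π(g) v`, is surjective (its range is a non-zero
  `G`-stable subspace);
* `exists_surjective_equivariant_of_invariants_ne_bot` — `π^K ≠ 0 ⇒ k[G/K] ↠ π` `G`-equivariantly;
* `invariants_ne_bot_of_surjective_equivariant` — conversely a `G`-equivariant surjection
  `k[G/K] ↠ π` onto a non-trivial `π` forces `π^K ≠ 0` (`f(δ_K)` is `K`-fixed and non-zero,
  since `f` is the `orbitLinear` of `f(δ_K)`); for `K`-finite `π` this is also the exactness of
  `V ↦ V^K` (`T5LevelIdempotentNaturality.map_invariants_eq_of_surjective`);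
* `invariants_ne_bot_iff_exists_surjective_equivariant` — the two together, for irreducible
  non-trivial `π`.

What stays prose: the printed theorems; that the unramified representations of the record are
the irreducible `K`-spherical ones for the hyperspecial `K` of the datum.
-/

namespace Summit.Ventures.HodgeRepro2.T5HeckeSphericalQuotient

open T5HeckePermutationModule LevelPositivity

variable {G : Type*} [Group G] {k : Type*} [Field k]
  {V : Type*} [AddCommGroup V] [Module k V] (ρ : Representation k G V) {K : Subgroup G}

/-- The range of `orbitLinear v : k[G/K] → π` is `G`-stable. -/
theorem apply_mem_range_orbitLinear {v : V} (hv : v ∈ invariants ρ K) (g : G) {w : V}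
    (hw : w ∈ LinearMap.range (orbitLinear ρ v hv)) :
    ρ g w ∈ LinearMap.range (orbitLinear ρ v hv) := by
  obtain ⟨t, rfl⟩ := hw
  refine ⟨Representation.ofMulAction k G (G ⧸ K) g t, ?_⟩
  exact (mem_equivariantHom_iff _ _).1 (orbitLinear_mem_equivariantHom ρ v hv) g t

/-- `v ∈ range (orbitLinear v)`: it is the image of `δ_K`. -/
theorem mem_range_orbitLinear_self {v : V} (hv : v ∈ invariants ρ K) :
    v ∈ LinearMap.range (orbitLinear ρ v hv) :=
  ⟨MonoidAlgebra.single ((1 : G) : G ⧸ K) 1, orbitLinear_single_one ρ v hv⟩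

/-- For irreducible `π` and `0 ≠ v ∈ π^K`, `orbitLinear v : k[G/K] → π` is surjective. -/
theorem range_orbitLinear_eq_top [ρ.IsIrreducible] {v : V} (hv : v ∈ invariants ρ K) (hv0 : v ≠ 0) :
    LinearMap.range (orbitLinear ρ v hv) = ⊤ := by
  rcases T5HeckeInvariantsDetermine.eq_bot_or_eq_top_of_stable ρ
    (S := LinearMap.range (orbitLinear ρ v hv))
    (fun g _ hw => apply_mem_range_orbitLinear ρ hv g hw) with h | h
  · exfalso
    apply hv0
    have := mem_range_orbitLinear_self ρ hv
    rw [h, Submodule.mem_bot] at this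
    exact this
  · exact h

/-- For irreducible `π` and `0 ≠ v ∈ π^K`, `orbitLinear v` is a `G`-equivariant surjection
`k[G/K] ↠ π`. -/
theorem orbitLinear_surjective [ρ.IsIrreducible] {v : V} (hv : v ∈ invariants ρ K) (hv0 : v ≠ 0) :
    Function.Surjective (orbitLinear ρ v hv) :=
  LinearMap.range_eq_top.1 (range_orbitLinear_eq_top ρ hv hv0)

/-- **Spherical ⇒ quotient of `k[G/K]`**: an irreducible `π` with `π^K ≠ 0` is a `G`-equivariant
quotient of the permutation representation `k[G/K]`. -/
theorem exists_surjective_equivariant_of_invariants_ne_bot [ρ.IsIrreducible]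
    (hne : invariants ρ K ≠ ⊥) :
    ∃ f : MonoidAlgebra k (G ⧸ K) →ₗ[k] V,
      f ∈ equivariantHom (Representation.ofMulAction k G (G ⧸ K)) ρ ∧ Function.Surjective f := by
  obtain ⟨v, hv, hv0⟩ := (Submodule.ne_bot_iff _).1 hne
  exact ⟨orbitLinear ρ v hv, orbitLinear_mem_equivariantHom ρ v hv, orbitLinear_surjective ρ hv hv0⟩

/-- The value at `δ_K` of a `G`-equivariant `f : k[G/K] → π` is `K`-fixed. -/
theorem apply_single_one_mem_invariants {f : MonoidAlgebra k (G ⧸ K) →ₗ[k] V}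
    (hf : f ∈ equivariantHom (Representation.ofMulAction k G (G ⧸ K)) ρ) :
    f (MonoidAlgebra.single ((1 : G) : G ⧸ K) 1) ∈ invariants ρ K := by
  rw [mem_invariants_iff]
  intro κ hκ
  rw [← (mem_equivariantHom_iff _ _).1 hf κ, Representation.ofMulAction_single]
  congr 2
  change ((κ * 1 : G) : G ⧸ K) = ((1 : G) : G ⧸ K)
  rw [QuotientGroup.eq]
  simp [hκ]

/-- **Quotient of `k[G/K]` ⇒ spherical**: a `G`-equivariant surjection `k[G/K] ↠ π` onto a
non-trivial `π` gives `π^K ≠ 0` (the image of `δ_K` is a non-zero `K`-fixed vector: `f` is the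
`orbitLinear` of `f(δ_K)`, so `f(δ_K) = 0` would force `f = 0`). -/
theorem invariants_ne_bot_of_surjective_equivariant [Nontrivial V]
    {f : MonoidAlgebra k (G ⧸ K) →ₗ[k] V}
    (hf : f ∈ equivariantHom (Representation.ofMulAction k G (G ⧸ K)) ρ)
    (hsurj : Function.Surjective f) : invariants ρ K ≠ ⊥ := by
  rw [Submodule.ne_bot_iff]
  refine ⟨f (MonoidAlgebra.single ((1 : G) : G ⧸ K) 1), apply_single_one_mem_invariants ρ hf, ?_⟩
  intro h0
  have hf0 : f = 0 := by
    rw [← orbitLinear_apply_single_one ρ hf]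
    have : orbitLinear ρ (f (MonoidAlgebra.single ((1 : G) : G ⧸ K) 1))
        (apply_single_one_mem_invariants ρ hf) = orbitLinear ρ 0 (Submodule.zero_mem _) := by
      congr 1
    rw [this, orbitLinear_zero]
  obtain ⟨x, hx⟩ := exists_ne (0 : V)
  obtain ⟨t, ht⟩ := hsurj x
  rw [hf0, LinearMap.zero_apply] at ht
  exact hx ht.symm

/-- **`π` is `K`-spherical iff `π` is a quotient of `k[G/K]`** (irreducible non-trivial `π`). -/
theorem invariants_ne_bot_iff_exists_surjective_equivariant [ρ.IsIrreducible] [Nontrivial V] :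
    invariants ρ K ≠ ⊥ ↔
      ∃ f : MonoidAlgebra k (G ⧸ K) →ₗ[k] V,
        f ∈ equivariantHom (Representation.ofMulAction k G (G ⧸ K)) ρ ∧ Function.Surjective f :=
  ⟨exists_surjective_equivariant_of_invariants_ne_bot ρ,
    fun ⟨_, hf, hsurj⟩ => invariants_ne_bot_of_surjective_equivariant ρ hf hsurj⟩

end Summit.Ventures.HodgeRepro2.T5HeckeSphericalQuotient
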